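import Mathlib

/-!
# The algebra of the pendant root at the statement vertex (blind cell PercRepro2, p1 g29)

The two polynomial inequalities behind the Q-pair forms of `CaseOneRootLeafAtA3`, in the abstract
masses of `G − e₀`: with `W = (1 − q) + q w′`, `Y = (1 − q) β + q y′`, `d = (1 − q) μ + q n′`,
`w′ · [W (W q u′ − Y q m′) − d (W q y′ − Y q w′)] = q [W² (u′ w′ − y′ m′) + (1 − q)(w′ β − y′)(d w′ − W m′)]`
and `w′ · [−W (W q u₃ − q y₃ q m′) + d (W q y₃ − q y₃ q w′)] = q [W² (y₃ m′ − u₃ w′) + (1 − q) y₃ (d w′ − W m′)]`,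
where `d w′ − W m′ = (1 − q)(w′ μ − m′) + q w′ (n′ − m′)`; each bracket is a BHK or Harris or
containment difference. Own code; standard axioms.
-/

namespace Summit.Ventures.PercRepro2

namespace CaseOne

section Alg
variable {R : Type*} [CommRing R] [LinearOrder R] [IsStrictOrderedRing R]

/-- `(ii-Q)` for the pendant root, as an inequality between the `G′`-masses. -/
lemma rootLeaf_iiQ_alg {q w' β μ y' m' u' n' : R} (hq : 0 ≤ q) (hq1 : q ≤ 1) (hw : 0 ≤ w')
    (hy : 0 ≤ y') (hm : 0 ≤ m') (hu0 : 0 ≤ u') (hu : u' ≤ w') (hbhk : y' * m' ≤ u' * w')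
    (hh1 : y' ≤ w' * β) (hh2 : m' ≤ w' * μ) (hmn : m' ≤ n') :
    0 ≤ ((1 - q) + q * w') * (((1 - q) + q * w') * (q * u') - ((1 - q) * β + q * y') * (q * m')) -
      ((1 - q) * μ + q * n') * (((1 - q) + q * w') * (q * y') - ((1 - q) * β + q * y') * (q * w')) := by
  rcases hw.eq_or_lt with h0 | hpos
  · -- `P′(Q′) = 0`: every `Q′`-mass vanishes
    have hy0 : y' = 0 := le_antisymm (by rw [← h0] at hh1; linarith) hy
    have hm0 : m' = 0 := le_antisymm (by rw [← h0] at hh2; linarith) hm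
    have hu' : u' = 0 := le_antisymm (h0 ▸ hu) hu0
    rw [← h0, hy0, hm0, hu']
    ring_nf
    exact le_rfl
  · have hW : 0 ≤ (1 - q) + q * w' := add_nonneg (sub_nonneg.2 hq1) (mul_nonneg hq hw)
    have hd : ((1 - q) + q * w') * m' ≤ ((1 - q) * μ + q * n') * w' := by
      have e : ((1 - q) * μ + q * n') * w' - ((1 - q) + q * w') * m' =
          (1 - q) * (w' * μ - m') + q * w' * (n' - m') := by ring
      have t1 := mul_nonneg (sub_nonneg.2 hq1) (sub_nonneg.2 hh2)
      have t2 := mul_nonneg (mul_nonneg hq hw) (sub_nonneg.2 hmn)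
      linarith
    have key : w' * (((1 - q) + q * w') * (((1 - q) + q * w') * (q * u') -
        ((1 - q) * β + q * y') * (q * m')) - ((1 - q) * μ + q * n') *
        (((1 - q) + q * w') * (q * y') - ((1 - q) * β + q * y') * (q * w'))) =
        q * (((1 - q) + q * w') ^ 2 * (u' * w' - y' * m') +
          (1 - q) * (w' * β - y') * (((1 - q) * μ + q * n') * w' - ((1 - q) + q * w') * m')) := by
      ring
    have hrhs : 0 ≤ q * (((1 - q) + q * w') ^ 2 * (u' * w' - y' * m') +
        (1 - q) * (w' * β - y') * (((1 - q) * μ + q * n') * w' - ((1 - q) + q * w') * m')) :=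
      mul_nonneg hq (add_nonneg (mul_nonneg (sq_nonneg _) (sub_nonneg.2 hbhk))
        (mul_nonneg (mul_nonneg (sub_nonneg.2 hq1) (sub_nonneg.2 hh1)) (sub_nonneg.2 hd)))
    rw [← key] at hrhs
    exact (mul_nonneg_iff_of_pos_left hpos).1 hrhs

/-- `(i-Q)` for the pendant root, as an inequality between the `G′`-masses. -/
lemma rootLeaf_iQ_alg {q w' μ m' u₃ y₃ n' : R} (hq : 0 ≤ q) (hq1 : q ≤ 1) (hw : 0 ≤ w')
    (hm : 0 ≤ m') (hμ : 0 ≤ μ) (hn : 0 ≤ n') (hy₃ : 0 ≤ y₃) (hu₃0 : 0 ≤ u₃) (hu₃ : u₃ ≤ w')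
    (hbhk : u₃ * w' ≤ y₃ * m') (hh2 : m' ≤ w' * μ) (hmn : m' ≤ n') :
    0 ≤ -(((1 - q) + q * w') * (((1 - q) + q * w') * (q * u₃) - (q * y₃) * (q * m'))) +
      ((1 - q) * μ + q * n') * (((1 - q) + q * w') * (q * y₃) - (q * y₃) * (q * w')) := by
  rcases hw.eq_or_lt with h0 | hpos
  · have hm0 : m' = 0 := le_antisymm (by rw [← h0] at hh2; linarith) hm
    have hu0 : u₃ = 0 := le_antisymm (h0 ▸ hu₃) hu₃0
    rw [← h0, hm0, hu0]
    have t := mul_nonneg (add_nonneg (mul_nonneg (sub_nonneg.2 hq1) hμ) (mul_nonneg hq hn))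
      (mul_nonneg (sub_nonneg.2 hq1) (mul_nonneg hq hy₃))
    linear_combination t
  · have hd : ((1 - q) + q * w') * m' ≤ ((1 - q) * μ + q * n') * w' := by
      have e : ((1 - q) * μ + q * n') * w' - ((1 - q) + q * w') * m' =
          (1 - q) * (w' * μ - m') + q * w' * (n' - m') := by ring
      have t1 := mul_nonneg (sub_nonneg.2 hq1) (sub_nonneg.2 hh2)
      have t2 := mul_nonneg (mul_nonneg hq hw) (sub_nonneg.2 hmn)
      linarith
    have key : w' * (-(((1 - q) + q * w') * (((1 - q) + q * w') * (q * u₃) - (q * y₃) * (q * m'))) +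
        ((1 - q) * μ + q * n') * (((1 - q) + q * w') * (q * y₃) - (q * y₃) * (q * w'))) =
        q * (((1 - q) + q * w') ^ 2 * (y₃ * m' - u₃ * w') +
          (1 - q) * y₃ * (((1 - q) * μ + q * n') * w' - ((1 - q) + q * w') * m')) := by
      ring
    have hrhs : 0 ≤ q * (((1 - q) + q * w') ^ 2 * (y₃ * m' - u₃ * w') +
        (1 - q) * y₃ * (((1 - q) * μ + q * n') * w' - ((1 - q) + q * w') * m')) :=
      mul_nonneg hq (add_nonneg (mul_nonneg (sq_nonneg _) (sub_nonneg.2 hbhk))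
        (mul_nonneg (mul_nonneg (sub_nonneg.2 hq1) hy₃) (sub_nonneg.2 hd)))
    rw [← key] at hrhs
    exact (mul_nonneg_iff_of_pos_left hpos).1 hrhs

end Alg

end CaseOne

end Summit.Ventures.PercRepro2
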